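import Summits.QuantumFields.YangMills.Theorems.BalabanUVNodesN07KnitTokensLandauOfG5
import Summits.QuantumFields.YangMills.Theorems.BalabanUVNodesN07FrakGOfRecordSliceFlat
import HarnessLib

/-!
# N07 ∕ K0ᴬ — THE KNIT CHAIN IS NOT VACUOUS ON THE FLAT LOCUS: at `U₀ = 1` the F-H row «`RD*(Emap H₁♭ C^{sl} ε_C A′) = 0`» and the (g2)-token HOLD for def-Y's CURRENT `H₁♭` (flat bare Hessian
# `∂*∂` kills every pure gauge mode: n07-w3 ✓`hessOpOfRecord_one_covDerivL2K`, ✓`QOfRecord_one_covDerivL2K_eq_zero`, ✓`hessOpOfRecord_one_isSymmetric`), so ✓`knitTokens_landau_two_of_g5` (LANDED-14)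
# at `U₀ = 1` displays ONLY file 4's rows + `HessSymmTok` + `Delta2Tok` + (g5) — RR-2's TRACE FLAG F-H located EXACTLY: the `H₁♭`-chain is print's ON the flat locus; OFF it the row is not a
# theorem for `H₁♭` (not print's) and is carried by the `π`-type charts (LANDED-13)

Cell `pub-ymgap`, seat `pub-ymgap-dag-n07-w3` (g29, WIDTH SEAT 3 on N07 [B11] = [15]); helper file keyed `--kind proof --supports stmt-QuantumFields-27238 --as helper` (K0ᴬ road);
count-neutral.  INTENT-15 of the seat.

## What is here

* §1 (any `N`, `U₀ = 1`) ★★ `RDstar_iota_H1OfRecordAtBgFlat_one_eq_zero` (`RD*(H₁♭B) = 0` at `U₀ = 1`: LANDED-13 §1 with `Δ₁ := Δ(1)` — `H₁♭ = H1OfRecordAt … (hessOpOfRecord …) …` by `rfl`),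
  ★★ `RDstar_iota_Emap_H1OfRecordAtBgFlat_one_eq_zero` (THE F-H ROW AT `U₀ = 1` for `H₁♭`, on `‖A′‖ < a_C` under the flat Sect. C regime).
* §2 (`N = 2`, `U₀ = 1`) ★★★ `knitTokens_landau_two_of_g5_one` — the four knit tokens for `Kc^L_ρ` at `𝔖♭.chartLin T♭`, background `U₀ = 1`, displayed def-Y-side rows: `HessSymmTok`, `Delta2Tok`,
  (g5) ONLY (F-H and (g2) discharged).

## Honest labels

The flat locus only (`U₀ = 1`); file 4's rows at `U₀ = 1` (`SmallBelow … 1`, `1 ∈ bgReg`, `RC`, `hCreal`, `hCtr`, `Prop4Hyp`, standard rows, numerics) stay displayed; by g27's ✓`K0AxTangentSocketOntoFlatLetters`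
at `U₀ = 1` `Delta2Tok ∧ Delta2SymmTok ↔ Δ⁽²⁾ = 0`.  Nothing of Bałaban's estimates proved; K0ᴬ ⟨27238⟩ NOT closed; N07 NOT discharged; COUNT∕K UNMOVED; R4 is the conditional finite-𝕋⁴ rung
`BalabanLadder.UV` only; finite torus at fixed `ε` — nothing continuum ∕ OS ∕ Clay.  **The Yang–Mills mass gap is NOT proved by any of this.**  No `sorry`, no `def`, no `instance ∕ notation ∕
set_option`; standard axioms.
[cite: Balaban1985Variational, Thm 1 p.279, Prop. 6 p.295, (45)–(47) p.285, (74)–(84) pp.289–290; Balaban1985BackgroundPropagators, (3.117) p.419, (3.124) p.420, (3.10) p.392]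
-/

noncomputable section

open Set Metric Filter Topology
open scoped Matrix Matrix.Norms.L2Operator InnerProductSpace ComplexConjugate

namespace Summit.QuantumFields.YangMills.Theorems.N07KnitTokensLandauFlatLocus

open Literature.MathematicalPhysics.QuantumFieldTheory.Balaban1983to89
open Literature.MathematicalPhysics.QuantumFieldTheory.Balaban1983to89.T4Continuum (T4Family)
open Literature.MathematicalPhysics.QuantumFieldTheory.Balaban1983to89.Node00
open B9Eq311TracePairing (starW)
open B11Eq103H1Complex (SiteL2K BondL2K readFun funEquiv QFun covDivL2K covDerivL2K covLaplaceSiteK)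
open B11Eq111FrakG (nabla115)
open B11Eq115Space (NegSize NegSup JetSup)
open B11Eq174Chart (Regime)
open B11Prop6Scheme (Prop4Hyp mapT)
open B11Eq90V0GroupComposed (T47)
open B11Eq80Current (Emap Emap_eq_H)
open Summit.QuantumFields.YangMills.Theorems.N07TraceSectorDefs (scalPartW)
open Summit.QuantumFields.YangMills.Theorems.N07KnitTokensLandauOfG5 (knitTokens_landau_two_of_g5)
open Summit.QuantumFields.YangMills.Theorems.N07H1LandauRowAtRecord (RDstar_iota_H1OfRecordAt_eq_zero)
open Summit.QuantumFields.YangMills.Theorems.N07FrakGOfRecordSliceFlat (hessOpOfRecord_one_covDerivL2K QOfRecord_one_covDerivL2K_eq_zero hessOpOfRecord_one_isSymmetric)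

/-! ## §1  The Landau row of `H₁♭` and the F-H row at `U₀ = 1` -/

section FlatAnyN

variable (F : T4Family) (N : ℕ) [NeZero N] {K : ℕ} (k : ℕ) (Ω : ℕ → Set (Site (F.P K) 0))
  [Fact (0 < (F.L : ℝ))] [Fact (0 < (F.P K).eta k)] (levB : PBond (F.P K) k → ℕ) [Fact (0 < c0Rec F K k)] [Fact (∀ c, 0 < wBRec F K k c)] (a : ℝ)
  (hposb : ∀ x, x ≠ 0 → 0 < RCLike.re ⟪x, laplaceAOfRecord F N k (1 : GaugeField (F.P K) 0 (SU N)) (QOfRecord F N k (1 : GaugeField (F.P K) 0 (SU N))) (QflatOfRecord F N k) a x⟫_ℂ)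
  (hQ : Function.Surjective (QOfRecord F N k (1 : GaugeField (F.P K) 0 (SU N)))) (εC : ℝ)
  (ι : Space115Lit F N K k Ω (1 : GaugeField (F.P K) 0 (SU N)) ≃ₗ[ℂ] BondL2K ℂ (F.P K).d (fun _ => (F.P K).sitesPerDir 0) (c0Rec F K k) (WRec N))
  (hι : ∀ y, ι y = (funEquiv (phiRec N) (fun _ : B9SectCLatticeCarrier.Bond (F.P K).d (fun _ => (F.P K).sitesPerDir 0) => c0Rec F K k)).symm
    (JetSup.equiv _ _ (nabla115 ((F.P K).eta k) (unitsOfRecord F N (1 : GaugeField (F.P K) 0 (SU N)))) y))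

include hι in
/-- ★★ **AT `U₀ = 1`: `RD*(H₁♭B) = 0`** — LANDED-13 §1 with `Δ₁ := Δ(1)` (symmetric ✓, kills every pure gauge mode ✓, `Q(1)` kills the `N(Q′♭)` ones ✓; `H₁♭ = H1OfRecordAt … (hessOpOfRecord …) …` by `rfl`).
[cite: Balaban1985Variational, (45) p.285; Balaban1985BackgroundPropagators, (3.117) p.419, (3.124) p.420] -/
theorem RDstar_iota_H1OfRecordAtBgFlat_one_eq_zero (B : NegSize (F.L : ℝ) ((F.P K).eta k) levB 0 (Matrix (Fin N) (Fin N) ℂ)) :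
    RrOfRecord F N k (1 : GaugeField (F.P K) 0 (SU N)) (QflatOfRecord F N k)
      (covDivL2K ℂ (c0Rec F K k) (cRec F K k) (SRec F N (1 : GaugeField (F.P K) 0 (SU N)))
        (ι (H1OfRecordAtBgFlat F N K k Ω (1 : GaugeField (F.P K) 0 (SU N)) levB a hposb hQ B))) = 0 := by
  have hpos' : ∀ x, x ≠ 0 → 0 < RCLike.re ⟪x, laplaceAOfRecordAt F N k (1 : GaugeField (F.P K) 0 (SU N)) (hessOpOfRecord F N k (1 : GaugeField (F.P K) 0 (SU N)))
      (QOfRecord F N k (1 : GaugeField (F.P K) 0 (SU N))) (QflatOfRecord F N k) a x⟫_ℂ := by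
    rw [laplaceAOfRecordAt_hessOpOfRecord]; exact hposb
  have h := RDstar_iota_H1OfRecordAt_eq_zero F N k Ω (1 : GaugeField (F.P K) 0 (SU N)) levB (hessOpOfRecord F N k (1 : GaugeField (F.P K) 0 (SU N))) a hpos' hQ ι hι
    (hessOpOfRecord_one_isSymmetric F N k) (fun l _ => hessOpOfRecord_one_covDerivL2K F N k l) (fun l hl => QOfRecord_one_covDerivL2K_eq_zero F N k l hl) B
  rw [H1OfRecordAt_hessOpOfRecord] at h
  rw [H1OfRecordAtBgFlat]
  exact h

include hι in
/-- ★★ **THE F-H ROW AT `U₀ = 1` FOR `H₁♭`**: on `‖A′‖ < a_C` under the flat Sect. C regime, `RD*(Emap H₁♭ C ε A′) = RD*(H₁♭(C(T47A′))) = 0` (✓`Emap_eq_H` + §1).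
[cite: Balaban1985Variational, (45)–(47) p.285, (76) p.289; Balaban1985BackgroundPropagators, (3.117) p.419] -/
theorem RDstar_iota_Emap_H1OfRecordAtBgFlat_one_eq_zero {𝒞 : Space115Lit F N K k Ω (1 : GaugeField (F.P K) 0 (SU N)) → NegSize (F.L : ℝ) ((F.P K).eta k) levB 0 (Matrix (Fin N) (Fin N) ℂ)}
    {b C₂ c₄ aC : ℝ} (RC : Regime (H1OfRecordAtBgFlat F N K k Ω (1 : GaugeField (F.P K) 0 (SU N)) levB a hposb hQ) 0 𝒞 b 0 C₂ c₄ 0 aC εC)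
    {A' : Space115Lit F N K k Ω (1 : GaugeField (F.P K) 0 (SU N))} (hA' : ‖A'‖ < aC) :
    RrOfRecord F N k (1 : GaugeField (F.P K) 0 (SU N)) (QflatOfRecord F N k)
      (covDivL2K ℂ (c0Rec F K k) (cRec F K k) (SRec F N (1 : GaugeField (F.P K) 0 (SU N)))
        (ι (Emap (H1OfRecordAtBgFlat F N K k Ω (1 : GaugeField (F.P K) 0 (SU N)) levB a hposb hQ) 𝒞 εC A'))) = 0 := by
  rw [Emap_eq_H RC hA']
  exact RDstar_iota_H1OfRecordAtBgFlat_one_eq_zero F N k Ω levB a hposb hQ ι hι _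

end FlatAnyN

/-! ## §2  The knit chain at `U₀ = 1`, `N = 2` -/

section Two

variable (F : T4Family) {K : ℕ} (k : ℕ) (Ω : ℕ → Set (Site (F.P K) 0)) 
  [Fact (0 < (F.L : ℝ))] [Fact (0 < (F.P K).eta k)] (levB : PBond (F.P K) k → ℕ) [Fact (0 < c0Rec F K k)] [Fact (∀ c, 0 < wBRec F K k c)] (a : ℝ)
  (hposb : ∀ x, x ≠ 0 → 0 < RCLike.re ⟪x, laplaceAOfRecord F 2 k (1 : GaugeField (F.P K) 0 (SU 2)) (QOfRecord F 2 k (1 : GaugeField (F.P K) 0 (SU 2))) (QflatOfRecord F 2 k) a x⟫_ℂ)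
  (hQ : Function.Surjective (QOfRecord F 2 k (1 : GaugeField (F.P K) 0 (SU 2)))) {b C₂ c₄ aC εC : ℝ}
  (RC : Regime (H1OfRecordAtBgFlat F 2 K k Ω (1 : GaugeField (F.P K) 0 (SU 2)) levB a hposb hQ) 0 (CslOfRecord F 2 K k Ω (1 : GaugeField (F.P K) 0 (SU 2)) levB) b 0 C₂ c₄ 0 aC εC)
  (hCreal : ∀ A : Space115Lit F 2 K k Ω (1 : GaugeField (F.P K) 0 (SU 2)),
    ((JetSup.equiv _ _ (nabla115 ((F.P K).eta k) (unitsOfRecord F 2 (1 : GaugeField (F.P K) 0 (SU 2))))).symm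
        (star (JetSup.equiv _ _ (nabla115 ((F.P K).eta k) (unitsOfRecord F 2 (1 : GaugeField (F.P K) 0 (SU 2)))) A)) : Space115Lit F 2 K k Ω (1 : GaugeField (F.P K) 0 (SU 2))) = A →
    ‖A‖ ≤ εC + aC → ((NegSup.equiv _ _).symm (star (NegSup.equiv _ _ (CslOfRecord F 2 K k Ω (1 : GaugeField (F.P K) 0 (SU 2)) levB A))) :
      NegSize (F.L : ℝ) ((F.P K).eta k) levB 0 (Matrix (Fin 2) (Fin 2) ℂ)) = CslOfRecord F 2 K k Ω (1 : GaugeField (F.P K) 0 (SU 2)) levB A)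
  (hCtr : ∀ A : Space115Lit F 2 K k Ω (1 : GaugeField (F.P K) 0 (SU 2)),
    ((JetSup.equiv _ _ (nabla115 ((F.P K).eta k) (unitsOfRecord F 2 (1 : GaugeField (F.P K) 0 (SU 2))))).symm
        (star (JetSup.equiv _ _ (nabla115 ((F.P K).eta k) (unitsOfRecord F 2 (1 : GaugeField (F.P K) 0 (SU 2)))) A)) : Space115Lit F 2 K k Ω (1 : GaugeField (F.P K) 0 (SU 2))) = A →
    (∀ b, (JetSup.equiv _ _ (nabla115 ((F.P K).eta k) (unitsOfRecord F 2 (1 : GaugeField (F.P K) 0 (SU 2)))) A b).trace = 0) →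
    ‖A‖ ≤ εC + aC → ∀ c, (NegSup.equiv _ _ (CslOfRecord F 2 K k Ω (1 : GaugeField (F.P K) 0 (SU 2)) levB A) c).trace = 0)
  (Gp : SiteL2K ℂ (F.P K).d (fun _ => (F.P K).sitesPerDir 0) (c0Rec F K k) (WRec 2) →ₗ[ℂ]
    SiteL2K ℂ (F.P K).d (fun _ => (F.P K).sitesPerDir 0) (c0Rec F K k) (WRec 2))
  (Δ2 : BondL2K ℂ (F.P K).d (fun _ => (F.P K).sitesPerDir 0) (c0Rec F K k) (WRec 2) →ₗ[ℂ]
    BondL2K ℂ (F.P K).d (fun _ => (F.P K).sitesPerDir 0) (c0Rec F K k) (WRec 2))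
  (hposπ : ∀ x, x ≠ 0 → 0 < RCLike.re ⟪x, laplaceAOfRecordAt F 2 k (1 : GaugeField (F.P K) 0 (SU 2)) (hessOpOfRecord128 F 2 k (1 : GaugeField (F.P K) 0 (SU 2)) Gp (QflatOfRecord F 2 k) Δ2)
    (QOfRecord F 2 k (1 : GaugeField (F.P K) 0 (SU 2))) (QflatOfRecord F 2 k) a x⟫_ℂ)


include RC hCreal hCtr in
/-- ★★★ **THE FOUR KNIT TOKENS AT `U₀ = 1`, `N = 2`, FOR THE LANDAU FAMILY — F-H ROW AND (g2) DISCHARGED** (✓`knitTokens_landau_two_of_g5` at the flat background with §1 and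
✓`QOfRecord_one_covDerivL2K_eq_zero`): displayed def-Y-side rows `HessSymmTok`, `Delta2Tok`, (g5) only.  The knit chain for def-Y's CURRENT `H₁♭` is INHABITED on the flat locus (its F-H
hypothesis is a theorem there); off the flat locus that row is not a theorem for `H₁♭` and is carried by the `π`-type charts (LANDED-13).
[cite: Balaban1985Variational, Thm 1 p.279, Prop. 6 p.295, (45)–(47) p.285, (74)–(84) pp.289–290; Balaban1985BackgroundPropagators, (3.117) p.419, (3.124) p.420] -/
theorem knitTokens_landau_two_of_g5_one (h : SmallBelow (avOfRecord F 2 K) k (1 : GaugeField (F.P K) 0 (SU 2))) {ε : ℝ} (hU₀reg : (1 : GaugeField (F.P K) 0 (SU 2)) ∈ bgReg F 2 K k ε)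
    (hC : Prop4Hyp (CslOfRecord F 2 K k Ω (1 : GaugeField (F.P K) 0 (SU 2)) levB) C₂ c₄) (haC : 0 < aC)
    (ι : Space115Lit F 2 K k Ω (1 : GaugeField (F.P K) 0 (SU 2)) ≃ₗ[ℂ] BondL2K ℂ (F.P K).d (fun _ => (F.P K).sitesPerDir 0) (c0Rec F K k) (WRec 2))
    (hι : ∀ y, ι y = (funEquiv (phiRec 2) (fun _ : B9SectCLatticeCarrier.Bond (F.P K).d (fun _ => (F.P K).sitesPerDir 0) => c0Rec F K k)).symm
      (JetSup.equiv _ _ (nabla115 ((F.P K).eta k) (unitsOfRecord F 2 (1 : GaugeField (F.P K) 0 (SU 2)))) y))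
    (hsym : HessSymmTok F 2 K k (1 : GaugeField (F.P K) 0 (SU 2)) Δ2) (hΔ2 : Delta2Tok F 2 K k Ω (1 : GaugeField (F.P K) 0 (SU 2)) levB a hposb hQ Δ2)
    (g5 : ∀ l : SiteL2K ℂ (F.P K).d (fun _ => (F.P K).sitesPerDir 0) (c0Rec F K k) (WRec 2), QflatOfRecord F 2 k l = 0 →
      Gp (covLaplaceSiteK (cRec F K k) (RRec F 2 (1 : GaugeField (F.P K) 0 (SU 2))) (SRec F 2 (1 : GaugeField (F.P K) 0 (SU 2))) l) = l) :
    ∃ ρ₀ M γ : ℝ, 0 < ρ₀ ∧ ρ₀ ≤ aC ∧ 0 ≤ M ∧ 0 < γ ∧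
      ∀ (dom : Set (GaugeField (F.P K) k (SU 2))) (B₀ C₄ a₃ j a𝔄 ε₄ ρ : ℝ)
        (S : BgSchemeOnLit F 2 K k Ω (1 : GaugeField (F.P K) 0 (SU 2))) (_hS : S = bgSchemeOfRecord F 2 K k Ω (1 : GaugeField (F.P K) 0 (SU 2)) dom levB Gp Δ2 a hposπ hposb hQ εC B₀ C₄ a₃ j a𝔄 ε₄),
        ρ ≤ ρ₀ → ε₄ + a𝔄 ≤ ρ → 2 * (ρ + a𝔄 + a𝔄) ≤ a₃ → 4 * M * B₀ * C₄ * (ρ + a𝔄 + a𝔄) < γ →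
        dom ⊆ logDiscOfRecord F 2 K k (1 : GaugeField (F.P K) 0 (SU 2)) → S.RegimeTok → FrakGSliceTok F 2 K k Ω (1 : GaugeField (F.P K) 0 (SU 2)) Gp Δ2 a hposπ hQ → (∀ V ∈ dom, S.LieTokAt V) →
        -- (rng)
        (∀ V ∈ S.dom, ∀ A ∈ {A : Space115Lit F 2 K k Ω (1 : GaugeField (F.P K) 0 (SU 2)) | A ∈ constraint102OfRecord F 2 K k Ω (1 : GaugeField (F.P K) 0 (SU 2)) ∧ A + S.𝔄 V ∈ S.evHerm0 ∧ ‖A + S.𝔄 V‖ < ρ},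
          S.chartLin (fun _ => T47 (H1OfRecordAtBgFlat F 2 K k Ω (1 : GaugeField (F.P K) 0 (SU 2)) levB a hposb hQ) (CslOfRecord F 2 K k Ω (1 : GaugeField (F.P K) 0 (SU 2)) levB) εC) V A ∈ bgReg F 2 K k ε ∧
          Averaging.iter (avOfRecord F 2 K) k
            (S.chartLin (fun _ => T47 (H1OfRecordAtBgFlat F 2 K k Ω (1 : GaugeField (F.P K) 0 (SU 2)) levB a hposb hQ) (CslOfRecord F 2 K k Ω (1 : GaugeField (F.P K) 0 (SU 2)) levB) εC) V A) = V) ∧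
        -- (star_mem)
        (∀ V ∈ S.dom, S.sol V ∈ {A : Space115Lit F 2 K k Ω (1 : GaugeField (F.P K) 0 (SU 2)) | A ∈ constraint102OfRecord F 2 K k Ω (1 : GaugeField (F.P K) 0 (SU 2)) ∧ A + S.𝔄 V ∈ S.evHerm0 ∧ ‖A + S.𝔄 V‖ < ρ}) ∧
        -- (min)
        (∀ V ∈ S.dom, IsMinOn (wilsonAction4 ∘ S.chartLin
              (fun _ => T47 (H1OfRecordAtBgFlat F 2 K k Ω (1 : GaugeField (F.P K) 0 (SU 2)) levB a hposb hQ) (CslOfRecord F 2 K k Ω (1 : GaugeField (F.P K) 0 (SU 2)) levB) εC) V)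
            {A : Space115Lit F 2 K k Ω (1 : GaugeField (F.P K) 0 (SU 2)) | A ∈ constraint102OfRecord F 2 K k Ω (1 : GaugeField (F.P K) 0 (SU 2)) ∧ A + S.𝔄 V ∈ S.evHerm0 ∧ ‖A + S.𝔄 V‖ < ρ} (S.sol V)) ∧
        -- (c→s)
        (∀ V ∈ S.dom, ∀ A ∈ {A : Space115Lit F 2 K k Ω (1 : GaugeField (F.P K) 0 (SU 2)) | A ∈ constraint102OfRecord F 2 K k Ω (1 : GaugeField (F.P K) 0 (SU 2)) ∧ A + S.𝔄 V ∈ S.evHerm0 ∧ ‖A + S.𝔄 V‖ < ρ},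
          IsMinOn (wilsonAction4 ∘ S.chartLin
              (fun _ => T47 (H1OfRecordAtBgFlat F 2 K k Ω (1 : GaugeField (F.P K) 0 (SU 2)) levB a hposb hQ) (CslOfRecord F 2 K k Ω (1 : GaugeField (F.P K) 0 (SU 2)) levB) εC) V)
            {A : Space115Lit F 2 K k Ω (1 : GaugeField (F.P K) 0 (SU 2)) | A ∈ constraint102OfRecord F 2 K k Ω (1 : GaugeField (F.P K) 0 (SU 2)) ∧ A + S.𝔄 V ∈ S.evHerm0 ∧ ‖A + S.𝔄 V‖ < ρ} A →
          ‖A‖ ≤ S.ε₄ ∧ mapT (S.𝒢 V) 0 (S.W V) (S.J V) (S.𝔄 V) A = A) := by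
  obtain ⟨ρ₀, M, γ, hρ₀, hρ₀aC, hM, hγ, hmain⟩ :=
    knitTokens_landau_two_of_g5 F k Ω (1 : GaugeField (F.P K) 0 (SU 2)) levB a hposb hQ RC hCreal hCtr Gp Δ2 hposπ h hU₀reg hC haC ι hι hsym hΔ2 g5
      (fun l hl => N07FrakGOfRecordSliceFlat.QOfRecord_one_covDerivL2K_eq_zero F 2 k l hl)
  refine ⟨ρ₀, M, γ, hρ₀, hρ₀aC, hM, hγ, ?_⟩
  intro dom B₀ C₄ a₃ j a𝔄 ε₄ ρ S hS hρ hfit hdom hnum hdisc hR h𝔊 hL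
  exact hmain dom B₀ C₄ a₃ j a𝔄 ε₄ ρ S hS hρ hfit hdom hnum hdisc hR h𝔊 hL
    (fun A' _ _ hlt => RDstar_iota_Emap_H1OfRecordAtBgFlat_one_eq_zero F 2 k Ω levB a hposb hQ εC ι hι RC (lt_of_lt_of_le hlt hρ₀aC))

end Two

/-! ## §3  (min) ∧ (c→s) at `U₀ = 1`, any `N` (v1.1, append-only)

ERRATUM to §2's docstring (ref-L g37 NIT-W, 2026-09-01): «the knit chain … is INHABITED on the flat locus» over-reads — what §1–§2 establish is that at `U₀ = 1` the F-H row AND the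
(g2)-token are THEOREMS for `H₁♭`; the other displayed rows (`HessSymmTok`, `Delta2Tok`, (g5), the flat Sect. C `Regime`, `hCreal`∕`hCtr`, `Prop4Hyp`, `RegimeTok`∕`FrakGSliceTok`∕`LieTokAt`,
`SmallBelow`, `1 ∈ bgReg`) stay displayed and their joint inhabitation is not exhibited here. -/

section FlatAnyNTokens

open B11Eq80Current (quadPart)
open B11Eq90Transpose (pair27)
open B11Eq90V0primeCurrent (flat115)
open B9Eq3119DeltaPiCarrier (currentCLM)
open Summit.QuantumFields.YangMills.Theorems.N07KnitTokensLandauOfG5 (minTokens_landau_of_g5)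

variable (F : T4Family) (N : ℕ) [NeZero N] {K : ℕ} (k : ℕ) (Ω : ℕ → Set (Site (F.P K) 0)) 
  [Fact (0 < (F.L : ℝ))] [Fact (0 < (F.P K).eta k)] (levB : PBond (F.P K) k → ℕ) [Fact (0 < c0Rec F K k)] [Fact (∀ c, 0 < wBRec F K k c)] (a : ℝ)
  (hposb : ∀ x, x ≠ 0 → 0 < RCLike.re ⟪x, laplaceAOfRecord F N k (1 : GaugeField (F.P K) 0 (SU N)) (QOfRecord F N k (1 : GaugeField (F.P K) 0 (SU N))) (QflatOfRecord F N k) a x⟫_ℂ)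
  (hQ : Function.Surjective (QOfRecord F N k (1 : GaugeField (F.P K) 0 (SU N)))) (εC : ℝ)
  (Gp : SiteL2K ℂ (F.P K).d (fun _ => (F.P K).sitesPerDir 0) (c0Rec F K k) (WRec N) →ₗ[ℂ]
    SiteL2K ℂ (F.P K).d (fun _ => (F.P K).sitesPerDir 0) (c0Rec F K k) (WRec N))
  (Δ2 : BondL2K ℂ (F.P K).d (fun _ => (F.P K).sitesPerDir 0) (c0Rec F K k) (WRec N) →ₗ[ℂ]
    BondL2K ℂ (F.P K).d (fun _ => (F.P K).sitesPerDir 0) (c0Rec F K k) (WRec N))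
  (hposπ : ∀ x, x ≠ 0 → 0 < RCLike.re ⟪x, laplaceAOfRecordAt F N k (1 : GaugeField (F.P K) 0 (SU N)) (hessOpOfRecord128 F N k (1 : GaugeField (F.P K) 0 (SU N)) Gp (QflatOfRecord F N k) Δ2)
    (QOfRecord F N k (1 : GaugeField (F.P K) 0 (SU N))) (QflatOfRecord F N k) a x⟫_ℂ)
  {b C₂ c₄ aC : ℝ}
  (RC : Regime (H1OfRecordAtBgFlat F N K k Ω (1 : GaugeField (F.P K) 0 (SU N)) levB a hposb hQ) 0 (CslOfRecord F N K k Ω (1 : GaugeField (F.P K) 0 (SU N)) levB) b 0 C₂ c₄ 0 aC εC)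
  (hC : Prop4Hyp (CslOfRecord F N K k Ω (1 : GaugeField (F.P K) 0 (SU N)) levB) C₂ c₄)
  (ι : Space115Lit F N K k Ω (1 : GaugeField (F.P K) 0 (SU N)) ≃ₗ[ℂ] BondL2K ℂ (F.P K).d (fun _ => (F.P K).sitesPerDir 0) (c0Rec F K k) (WRec N))
  (hι : ∀ y, ι y = (funEquiv (phiRec N) (fun _ : B9SectCLatticeCarrier.Bond (F.P K).d (fun _ => (F.P K).sitesPerDir 0) => c0Rec F K k)).symm
    (JetSup.equiv _ _ (nabla115 ((F.P K).eta k) (unitsOfRecord F N (1 : GaugeField (F.P K) 0 (SU N)))) y))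

include hι RC hC in
/-- ★★★ **(min) ∧ (c→s) AT `U₀ = 1`, ANY `N`, F-H ROW AND (g2) DISCHARGED** (✓`minTokens_landau_of_g5` at the flat background with §1 and ✓`QOfRecord_one_covDerivL2K_eq_zero`): displayed
def-Y-side rows `hsym`, `Delta2Tok`-shape, (g5), and the `T47` reality∕trace rows (theorems at `N = 2`).
[cite: Balaban1985Variational, Thm 1 p.279, Prop. 6 p.295, (45)–(47) p.285, (74)–(84) pp.289–290; Balaban1985BackgroundPropagators, (3.117) p.419, (3.124) p.420] -/
theorem minTokens_landau_of_g5_one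
    (hsym : ∀ x y, ⟪hessOpOfRecord128 F N k (1 : GaugeField (F.P K) 0 (SU N)) Gp (QflatOfRecord F N k) Δ2 x, y⟫_ℂ = ⟪x, hessOpOfRecord128 F N k (1 : GaugeField (F.P K) 0 (SU N)) Gp (QflatOfRecord F N k) Δ2 y⟫_ℂ)
    (hΔ2 : ∀ A' : Space115Lit F N K k Ω (1 : GaugeField (F.P K) 0 (SU N)),
      pair27 (tauRecCLM N) (currentCLM (phiRec N) (pairLevLit F Ω k) (nabla115 ((F.P K).eta k) (unitsOfRecord F N (1 : GaugeField (F.P K) 0 (SU N)))) Δ2 A') (flat115 A') =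
        -2 * pair27 (tauRecCLM N) (JOfRecordAtBg F N K k Ω (1 : GaugeField (F.P K) 0 (SU N)))
          (flat115 (H1OfRecordAtBgFlat F N K k Ω (1 : GaugeField (F.P K) 0 (SU N)) levB a hposb hQ (quadPart (CslOfRecord F N K k Ω (1 : GaugeField (F.P K) 0 (SU N)) levB) A'))))
    (g5 : (∀ l : SiteL2K ℂ (F.P K).d (fun _ => (F.P K).sitesPerDir 0) (c0Rec F K k) (WRec N), QflatOfRecord F N k l = 0 →
      Gp (covLaplaceSiteK (cRec F K k) (RRec F N (1 : GaugeField (F.P K) 0 (SU N))) (SRec F N (1 : GaugeField (F.P K) 0 (SU N))) l) = l))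
    :
    ∃ M γ : ℝ, 0 ≤ M ∧ 0 < γ ∧
      ∀ (dom : Set (GaugeField (F.P K) k (SU N))) (B₀ C₄ a₃ j a𝔄 ε₄ ρ : ℝ)
        (S : BgSchemeOnLit F N K k Ω (1 : GaugeField (F.P K) 0 (SU N))) (_hS : S = bgSchemeOfRecord F N K k Ω (1 : GaugeField (F.P K) 0 (SU N)) dom levB Gp Δ2 a hposπ hposb hQ εC B₀ C₄ a₃ j a𝔄 ε₄),
        ρ ≤ aC → ε₄ + a𝔄 ≤ ρ → 2 * (ρ + a𝔄 + a𝔄) ≤ a₃ → 4 * M * B₀ * C₄ * (ρ + a𝔄 + a𝔄) < γ →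
        S.RegimeTok → FrakGSliceTok F N K k Ω (1 : GaugeField (F.P K) 0 (SU N)) Gp Δ2 a hposπ hQ → (∀ V ∈ dom, S.LieTokAt V) →
        (∀ A' : Space115Lit F N K k Ω (1 : GaugeField (F.P K) 0 (SU N)), A' ∈ S.evHerm0 → RrOfRecord F N k (1 : GaugeField (F.P K) 0 (SU N)) (QflatOfRecord F N k) (covDivL2K ℂ (c0Rec F K k) (cRec F K k) (SRec F N (1 : GaugeField (F.P K) 0 (SU N))) (ι A')) = 0 → ‖A'‖ < ρ →
          (∀ b', star (JetSup.equiv _ _ (nabla115 ((F.P K).eta k) (unitsOfRecord F N (1 : GaugeField (F.P K) 0 (SU N)))) (T47 (H1OfRecordAtBgFlat F N K k Ω (1 : GaugeField (F.P K) 0 (SU N)) levB a hposb hQ) (CslOfRecord F N K k Ω (1 : GaugeField (F.P K) 0 (SU N)) levB) εC A') b') =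
            JetSup.equiv _ _ (nabla115 ((F.P K).eta k) (unitsOfRecord F N (1 : GaugeField (F.P K) 0 (SU N)))) (T47 (H1OfRecordAtBgFlat F N K k Ω (1 : GaugeField (F.P K) 0 (SU N)) levB a hposb hQ) (CslOfRecord F N K k Ω (1 : GaugeField (F.P K) 0 (SU N)) levB) εC A') b') ∧
          (∀ b', Matrix.trace (JetSup.equiv _ _ (nabla115 ((F.P K).eta k) (unitsOfRecord F N (1 : GaugeField (F.P K) 0 (SU N)))) (T47 (H1OfRecordAtBgFlat F N K k Ω (1 : GaugeField (F.P K) 0 (SU N)) levB a hposb hQ) (CslOfRecord F N K k Ω (1 : GaugeField (F.P K) 0 (SU N)) levB) εC A') b') = 0)) →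
        (∀ V ∈ dom, IsMinOn (wilsonAction4 ∘ S.chartLin (fun _ => T47 (H1OfRecordAtBgFlat F N K k Ω (1 : GaugeField (F.P K) 0 (SU N)) levB a hposb hQ) (CslOfRecord F N K k Ω (1 : GaugeField (F.P K) 0 (SU N)) levB) εC) V) {A : Space115Lit F N K k Ω (1 : GaugeField (F.P K) 0 (SU N)) | A ∈ constraint102OfRecord F N K k Ω (1 : GaugeField (F.P K) 0 (SU N)) ∧ A + S.𝔄 V ∈ S.evHerm0 ∧ ‖A + S.𝔄 V‖ < ρ} (S.sol V)) ∧
        (∀ V ∈ dom, ∀ A ∈ {A : Space115Lit F N K k Ω (1 : GaugeField (F.P K) 0 (SU N)) | A ∈ constraint102OfRecord F N K k Ω (1 : GaugeField (F.P K) 0 (SU N)) ∧ A + S.𝔄 V ∈ S.evHerm0 ∧ ‖A + S.𝔄 V‖ < ρ},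
          IsMinOn (wilsonAction4 ∘ S.chartLin (fun _ => T47 (H1OfRecordAtBgFlat F N K k Ω (1 : GaugeField (F.P K) 0 (SU N)) levB a hposb hQ) (CslOfRecord F N K k Ω (1 : GaugeField (F.P K) 0 (SU N)) levB) εC) V) {A : Space115Lit F N K k Ω (1 : GaugeField (F.P K) 0 (SU N)) | A ∈ constraint102OfRecord F N K k Ω (1 : GaugeField (F.P K) 0 (SU N)) ∧ A + S.𝔄 V ∈ S.evHerm0 ∧ ‖A + S.𝔄 V‖ < ρ} A → ‖A‖ ≤ S.ε₄ ∧ mapT (S.𝒢 V) 0 (S.W V) (S.J V) (S.𝔄 V) A = A) := by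
  obtain ⟨M, γ, hM, hγ, hmin⟩ := minTokens_landau_of_g5 F N k Ω (1 : GaugeField (F.P K) 0 (SU N)) levB a hposb hQ εC Gp Δ2 hposπ RC hC ι hι hsym hΔ2 g5
    (fun l hl => QOfRecord_one_covDerivL2K_eq_zero F N k l hl)
  refine ⟨M, γ, hM, hγ, ?_⟩
  intro dom B₀ C₄ a₃ j a𝔄 ε₄ ρ S hS hρaC hfit hdom hnum hR h𝔊 hL hT47
  exact hmin dom B₀ C₄ a₃ j a𝔄 ε₄ ρ S hS hρaC hfit hdom hnum hR h𝔊 hL hT47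
    (fun A' _ _ hlt => RDstar_iota_Emap_H1OfRecordAtBgFlat_one_eq_zero F N k Ω levB a hposb hQ εC ι hι RC (lt_of_lt_of_le hlt hρaC))

end FlatAnyNTokens


end Summit.QuantumFields.YangMills.Theorems.N07KnitTokensLandauFlatLocus

end
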